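import Summits.AtomisticToContinuum.FouriersLaw.Theses.LocalOhmBV
import Literature.MathematicalPhysics.KineticTheory.LangevinChainGibbs

/-!
# Odd observables have zero covariance with the energy in the finite-`N` Gibbs state

Helper for stub `stub_equilibriumPackage` (S2b, the equilibrium / thermodynamic-limit package of the
extraction step; clause (b2b)) of the birth line of crux `LocalOhmBV.LocalOhm`
(item stmt-AtomisticToContinuum-12009). In the extraction the normalised response functional subtracts
the linearised local-equilibrium part `θ(x) · Cov_{μ_{N,T,T}}(ψ, H_N)/T²`; for the bond currents
`ψ = j_i` this part vanishes because `j_i` is odd and `H_N` even under the momentum reversal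
`(q, p) ↦ (q, -p)`, which preserves the Gibbs measure `gibbsMeasure N T` of ANY oscillator chain. We record the general odd × even identity and its two specialisations (`∫ j_i H_N dμ_T = 0`,
`Cov_{μ_T}(j_i, H_N) = 0`), with no integrability hypotheses (momentum reversal preserves Lebesgue
measure, so both sides are the same Bochner integral up to sign). No definitions.
-/

set_option autoImplicit false

noncomputable section

namespace Summit.AtomisticToContinuum.FouriersLaw.Theorems.LocalOhmBirth

open MeasureTheory
open Literature.MathematicalPhysics.KineticTheory.HeatConduction

variable {N : ℕ}

/-- **Odd times even integrates to zero in the Gibbs state.** For any oscillator chain `P`, any `N`,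
`T`, an observable `f` odd under momentum reversal and an observable `g` even under it,
`∫ f g dμ_T = 0` for `μ_T = gibbsMeasure N T` (the weight `e^{-H/T}` is even, Lebesgue measure is
reversal invariant; no integrability is needed since the reversed integral is literally `-∫ f g`).
[folklore] -/
theorem integral_odd_mul_even_gibbsMeasure (P : OscillatorChain) (N : ℕ) (T : ℝ)
    {f g : PhaseSpace N → ℝ} (hf : ∀ x : PhaseSpace N, f (x.1, -x.2) = -f x)
    (hg : ∀ x : PhaseSpace N, g (x.1, -x.2) = g x) :
    ∫ x, f x * g x ∂(P.gibbsMeasure N T) = 0 := by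
  rw [P.integral_gibbsMeasure]
  have h := integral_comp_momentumReversal N fun x => f x * g x * P.gibbsDensity N T x
  simp only [hf, hg, OscillatorChain.gibbsDensity, OscillatorChain.hamiltonian_neg_momentum, neg_mul,
    integral_neg] at h
  have h0 : ∫ x, f x * g x * P.gibbsDensity N T x = 0 := by
    simp only [OscillatorChain.gibbsDensity]
    linarith
  rw [h0, mul_zero]

/-- **An odd observable has zero Gibbs mean**: `∫ f dμ_T = 0` if `f(q, -p) = -f(q, p)`. [folklore] -/
theorem integral_odd_gibbsMeasure (P : OscillatorChain) (N : ℕ) (T : ℝ)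
    {f : PhaseSpace N → ℝ} (hf : ∀ x : PhaseSpace N, f (x.1, -x.2) = -f x) :
    ∫ x, f x ∂(P.gibbsMeasure N T) = 0 := by
  have h := integral_odd_mul_even_gibbsMeasure P N T hf (g := fun _ => (1 : ℝ)) fun _ => rfl
  simpa using h

/-- **The bond current is uncorrelated with the energy at equilibrium** (second-moment form):
`∫ j_i · H_N dμ_T = 0` for every oscillator chain, `N`, `T` and bond `i` (`j_i` odd, `H_N` even
under momentum reversal). [folklore] -/
theorem integral_bondCurrent_mul_hamiltonian_gibbsMeasure (P : OscillatorChain) (N : ℕ) (T : ℝ)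
    (i : Fin N) :
    ∫ x, P.bondCurrent N i x * P.hamiltonian N x ∂(P.gibbsMeasure N T) = 0 :=
  integral_odd_mul_even_gibbsMeasure P N T (P.bondCurrent_neg_momentum N i)
    (P.hamiltonian_neg_momentum N)

/-- **`Cov_{μ_T}(j_i, H_N) = 0`** in the form in which the covariance with the energy enters the
linearised local-equilibrium correction of the birth line of `LocalOhm`
(`∫ ψ H_N dμ - (∫ ψ dμ)(∫ H_N dμ)` with `ψ = j_i`, `μ = gibbsMeasure N T`). [folklore] -/
theorem cov_bondCurrent_hamiltonian_gibbsMeasure (P : OscillatorChain) (N : ℕ) (T : ℝ)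
    (i : Fin N) :
    (∫ x, P.bondCurrent N i x * P.hamiltonian N x ∂(P.gibbsMeasure N T)) -
        (∫ x, P.bondCurrent N i x ∂(P.gibbsMeasure N T)) *
          (∫ x, P.hamiltonian N x ∂(P.gibbsMeasure N T)) = 0 := by
  rw [integral_bondCurrent_mul_hamiltonian_gibbsMeasure P N T i,
    integral_odd_gibbsMeasure P N T (P.bondCurrent_neg_momentum N i), zero_mul, sub_zero]

/-- The same two facts for an odd observable `f` against an even weight `g` in covariance form:
`∫ f g dμ_T - (∫ f dμ_T)(∫ g dμ_T) = 0`. [folklore] -/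
theorem cov_odd_even_gibbsMeasure (P : OscillatorChain) (N : ℕ) (T : ℝ)
    {f g : PhaseSpace N → ℝ} (hf : ∀ x : PhaseSpace N, f (x.1, -x.2) = -f x)
    (hg : ∀ x : PhaseSpace N, g (x.1, -x.2) = g x) :
    (∫ x, f x * g x ∂(P.gibbsMeasure N T)) -
        (∫ x, f x ∂(P.gibbsMeasure N T)) * (∫ x, g x ∂(P.gibbsMeasure N T)) = 0 := by
  rw [integral_odd_mul_even_gibbsMeasure P N T hf hg, integral_odd_gibbsMeasure P N T hf, zero_mul,
    sub_zero]

/-- **Registered sub-goal (clause (b2b) of `stub_equilibriumPackage`)**: `Cov_{μ_T}(j_i, H_N) = 0` for the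
pinned chain, every `N`, `T`, `i`. [folklore] -/
theorem equilibriumPackage_covBondCurrentEnergy :
    ∀ ω₂ lam β γ : ℝ, ∀ T : ℝ, ∀ (N : ℕ) (i : Fin N),
      (∫ z, (pinnedChain ω₂ lam β γ).bondCurrent N i z * (pinnedChain ω₂ lam β γ).hamiltonian N z
          ∂((pinnedChain ω₂ lam β γ).gibbsMeasure N T)) -
        (∫ z, (pinnedChain ω₂ lam β γ).bondCurrent N i z ∂((pinnedChain ω₂ lam β γ).gibbsMeasure N T)) *
          (∫ z, (pinnedChain ω₂ lam β γ).hamiltonian N z ∂((pinnedChain ω₂ lam β γ).gibbsMeasure N T)) = 0 :=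
  fun ω₂ lam β γ T N i => cov_bondCurrent_hamiltonian_gibbsMeasure (pinnedChain ω₂ lam β γ) N T i

end Summit.AtomisticToContinuum.FouriersLaw.Theorems.LocalOhmBirth

end
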